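import Summits.Ventures.PackingBounds.Energy.FivePointRieszSixGramFast1
import Summits.Ventures.PackingBounds.Energy.FivePointRieszSixGramFast2
import Summits.Ventures.PackingBounds.Energy.FivePointRieszSixGramFast3
import Summits.Ventures.PackingBounds.Energy.FivePointRieszSixGramFast4
import Summits.Ventures.PackingBounds.Energy.FivePointRieszSixGramFast5
import Summits.Ventures.PackingBounds.Energy.FivePointRieszSixGramFast6
import Summits.Ventures.PackingBounds.Energy.FivePointRieszSixGramFast7
import Summits.Ventures.PackingBounds.Energy.FivePointRieszSixGramFast8
import Summits.Ventures.PackingBounds.Energy.FivePointRieszSixGramFast9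
import Summits.Ventures.PackingBounds.Energy.FivePointRieszSixGramFast10
import HarnessLib

/-!
# The 158 × 158 SOS Gram block of `e3pt-sharp-n3N5s6d8-none.json` satisfies the integer PSD checks (collected)

Framing: lottery ticket; floor = certified bounds/negative ranges. Venture `PackingBounds`, cell
`pub-packcert`, energy family E3PT (pub-packcert-energy gen 15; n = 3, d = 8 kernel route = KERNEL-D6 double data route, size-split).

Diagonal dominance of `E` (`GramData.checkDD`, kernel evaluation), the row lengths of `L` (`GramData.checkLen`) and the collection `rowsR6_all` of the row-chunk
theorems of `FivePointRieszSixGramFast1..10`; `GramData.psd_of_checks` then gives `Σ (S·Y)_ij y_i y_j ≥ 0` (applied in `FivePointRieszSixSOS` through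
`GramData.listQuad_nonneg_of_congr`).
-/

namespace Summit.Ventures.PackingBounds.Energy.RieszSixD8

open Summit.Ventures.PackingBounds.Energy.GramData

set_option maxRecDepth 100000 in
set_option maxHeartbeats 0 in
/-- `E` is diagonally dominant: `Σ_j |E_ij| ≤ 2 E_ii` for all rows (kernel evaluation). -/
theorem ddR6_all : checkDD 158 eR6 = true := by decide +kernel

set_option maxRecDepth 100000 in
set_option maxHeartbeats 0 in
/-- Every row of `lR6` has length 158 (kernel evaluation). -/
theorem lenR6_L : checkLen 158 lR6 = true := by decide +kernel

/-- All rows: `(S·Y)_ij = Σ_c L_ic L_jc + E_ij` and `E_ij = E_ji` for `i, j < 158`. -/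
theorem rowsR6_all : ∀ i j, i < 158 → j < 158 →
    ent yR6 i j = dotRows lR6 i j 158 + ent eR6 i j ∧ ent eR6 i j = ent eR6 j i := by
  intro i j hi hj
  by_cases h0 : i < 16
  · exact of_checkRowsF rowsR6_0_16 lenR6_L i j (Nat.zero_le _) h0 hi hj
  by_cases h1 : i < 32
  · exact of_checkRowsF rowsR6_16_32 lenR6_L i j (by omega) h1 hi hj
  by_cases h2 : i < 48
  · exact of_checkRowsF rowsR6_32_48 lenR6_L i j (by omega) h2 hi hj
  by_cases h3 : i < 64
  · exact of_checkRowsF rowsR6_48_64 lenR6_L i j (by omega) h3 hi hj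
  by_cases h4 : i < 80
  · exact of_checkRowsF rowsR6_64_80 lenR6_L i j (by omega) h4 hi hj
  by_cases h5 : i < 96
  · exact of_checkRowsF rowsR6_80_96 lenR6_L i j (by omega) h5 hi hj
  by_cases h6 : i < 112
  · exact of_checkRowsF rowsR6_96_112 lenR6_L i j (by omega) h6 hi hj
  by_cases h7 : i < 128
  · exact of_checkRowsF rowsR6_112_128 lenR6_L i j (by omega) h7 hi hj
  by_cases h8 : i < 144
  · exact of_checkRowsF rowsR6_128_144 lenR6_L i j (by omega) h8 hi hj
  · exact of_checkRowsF rowsR6_144_158 lenR6_L i j (by omega) hi hi hj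

end Summit.Ventures.PackingBounds.Energy.RieszSixD8
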